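import Summits.BirchSwinnertonDyer.Rank1Residual.Supersingular.X6RankOneHalvesFromPrint
import HarnessLib

/-!
# Class X6, analytic rank `1`, `p ≥ 5`: the ONE remaining input in FRAME FORM (∃∧-currency) — per
# datum ONE frame carrying Castella 2018 Thm. 3.1's interpolation ∧ Thm. 3.2's value at `𝟙` ∧ the
# one-sided anticyclotomic divisibility `Ch_Λ(X_ac)·R₀⟦T⟧ ⊆ (L)` FOR THAT FRAME; the dischargeable
# currency of a refereed statement about ONE `p`-adic `L`-function (cell `b2b-bsdres`, literature typer
# seat `lit-cw`, gen 14; sequel of `X6RankOneHalvesFromPrint.lean` (gen 13); the X6 twin of multr1-p2's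
# `X11b/BDPRouteOpenInputFrame.lean` and multr1-p1's `X11b/RouteR1IMCEqFrame.lean`)

HONEST FRAMING (cell `b2b-bsdres`, run/shared/lean/b2b/bsd-rank1-residual/, verbatim in every
file): the goal of the cell is to DELETE the COMBINATION-SHAPED residual classes of the
Birch–Swinnerton-Dyer formula for ALL analytic-rank `≤ 1` elliptic curves over `ℚ` — "full BSD
formula for every rank `≤ 1` curve in class `C`" assembled STRICTLY from published theorems — so
that the rank-`≤ 1` remainder becomes exactly the CONSTRUCTION-SHAPED classes, which are TYPED
(missing-input `Prop`s), NOT attempted. This is not "finishing BSD". Research routes; no claim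
beyond stated classes. Two `Prop`-valued SHAPES with parameters (OPEN; nothing asserted, NEVER a
theorem in this cell) and THEOREMS; no named fact, no `sorry`; nothing booked; no label is moved by
this file (the referee rules; R-X6-JSW-LOWER-2); X6 ∩ {`r_an = 1`} stays CONSTRUCTION-SHAPED. NEW
WORK of the cell, hence under `Summits/`.

## Why a second currency (multr1-p1 GEN 22, HOME INBOX 2026-08-21T09:47Z)

Gen 13 typed the remaining input of the X6 ∧ {`r_an = 1`} ∧ {`p ≥ 5`} statements in ∀-FRAME
currency: `X6.IMCDivOnErratumData W p q` / `X6.IMCDivOnClassicalData W p` demand the divisibility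
`Ch_Λ(X_ac^∅(E_K[p^∞]))·R₀⟦T⟧ ⊆ (L)` at EVERY frame `(Ω_K, Ω_p, L)` with `IsBDPLFunction`. A refereed
statement about ONE `p`-adic `L`-function (Castella–Wan 2024 Thm. 5.3 for its own `L_p^{BDP}`;
Castella 2018 Thms. 3.1–3.2 for its own `L_p(f)`) is, in the registry's ∃∧-currency, ONE frame: it
does not discharge a ∀-frame shape (across frames with different periods the ∀-frame statement is
genuinely stronger; at fixed periods the two agree only under a supply-of-characters hypothesis,
multr1-p1's `X11b/BDPFrameUniqueness.lean`). Hence this file: **`X6.IMCDivFrameOnErratumData W p q`**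
and **`X6.IMCDivFrameOnClassicalData W p`** — at each `(datum, κ, γ, ι', w₀, P', e)` THERE IS a frame
`(Ω_K ≠ 0, Ω_p ∈ R₀ˣ, L ∈ R₀⟦T⟧)` with Cas18 Thm. 3.1's interpolation property ∧ Thm. 3.2's value at
`𝟙` (A222's raw shape) ∧ the divisibility FOR THAT `L`. Proved here: (gen-13 halves) `h32` + the
∀-frame divisibility ⟹ frame form (§2), so the frame form is WEAKER than everything this seat typed
before on these data; and it is what a jointly-typed refereed fact "interpolation ∧ value at `𝟙` ∧
one-sided divisibility for the SAME `L`" would instantiate directly. The companion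
`X6RankOneFrameFormRecord.lean` (same gen) runs the gen-13 descent on the ONE frame the shape
provides (frame form ⟹ lit-glue's composite link `X11b.IMCLowerWaldspurgerOnTreeGoodAt` at every
degree-one `𝔭 ∣ p`) and states the records over the frame form with ONE published named fact FEWER
than gen 13's (`h32` is then inside the shape's PUB-shaped conjuncts).

WHAT IS AND IS NOT IN PRINT (recorded, not booked; the referee rules): on an erratum-type field of
the sub-locus the three conjuncts are, respectively, Cas18 Thm. 3.1 and Thm. 3.2 (A222, PUBLISHED;
semistable `E`, `p ≥ 5`, `ρ̄` irreducible, `p` split, (Heeg); no ordinarity, `ε_p = p⁻¹` at `p ∤ N`)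
and — for Castella–Wan's OWN normalisation `L_p^{BDP} = (𝓛_𝔭^{BDP})²` (CW24 Prop. 2.1), not for
Castella 2018's `L_p(f)` — CW24 Thm. 5.3 (⇐ CLW22 Thm. 8.2.3 (1) + 2024 addendum; `p ≥ 5` good,
(i) `N` squarefree, (ii) some `ℓ ∣ N` non-split = the ramified `q`, (iii) built in, `N⁻ = 1` so the
integral clause is vacuous; tacit `ρ̄|_{G_K}` irreducible automatic at supersingular `p`). NOT in
print: the frame concordance (c1)/(c3) identifying the ideal `(L)` of a Cas18-normalised frame with
CW24's `(L_p^{BDP})` in `Λ^ur = R₀⟦T⟧` (HOME/b2b-bsdres-lit-cw/CASTELLA-WAN.md §8.6, §17.3, §18),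
and CW24 prints no value at `𝟙` for its `𝓛_𝔭^{BDP}`. At a CLASSICAL (all-split) field hypothesis
(ii) FAILS — the third conjunct is not in print at a supersingular `p` (CCSS / BSTW preprints). Every
result here is CONDITIONAL; no tier or label is moved by this file.

* §1 defs **`X6.IMCDivFrameOnErratumData W p q`**, **`X6.IMCDivFrameOnClassicalData W p`** (OPEN shapes).
* §2 `X6.imcDivFrameOnErratumData_of_thm32_of_imcDiv`, `X6.imcDivFrameOnClassicalData_of_thm32_of_imcDiv`
  (gen-13 halves ⟹ frame form; class-keyed variants `…_of_classX6`).
* §3–§4 (composite link and records over the frame form): `X6RankOneFrameFormRecord.lean`.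

References: [Castella2018] §2.1, Thms. 2.3, 3.1, display (3.2), 3.2, §5 (arXiv:1704.06608 pp. 5, 9,
12); [CastellaWan2023] Prop. 2.1 (MS p. 6), Conj. 5.2, Thm. 5.3 (MS pp. 23–25), proof of Thm. 6.11
(MS p. 33); [CastellaLiuWan2022] §5.2, Thm. 8.2.3; [Sprung2024] Cor. 1.3 (ii); [Wuthrich2014]
Prop. 21; [GrossZagier1986] Thm. I.7.3; [GrossLMS1991] Thm. 1.3; [Diamond1995RefinedSerre] Thm. 1.1.
-/

set_option autoImplicit false

noncomputable section

open scoped Classical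

open WeierstrassCurve NumberField IsDedekindDomain Field PowerSeries
  Literature.NumberTheory.EllipticCurves
  Literature.NumberTheory.EllipticCurves.ModularForms
  Literature.NumberTheory.EllipticCurves.Rank1Residual
  Literature.NumberTheory.EllipticCurves.Rank1Residual.Typed
  Literature.NumberTheory.EllipticCurves.Wuthrich2014
  Literature.NumberTheory.Automorphic
  Literature.NumberTheory.EllipticCurves.JetchevSkinnerWan2017
  Literature.NumberTheory.EllipticCurves.Castella2018
  Literature.NumberTheory.GaloisRepresentations
  Summit.BirchSwinnertonDyer.Rank1Residual.X11b.AcSelmer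
  Summit.BirchSwinnertonDyer.Rank1Residual.X11b.Halves
  Summit.BirchSwinnertonDyer.Rank1Residual.X11b.CongruenceLimit

namespace Summit.BirchSwinnertonDyer.Rank1Residual

namespace Supersingular

/-! ### §1 The ONE remaining input in frame form (∃∧-currency) on the two X6 data shapes -/

section Shapes

variable (W : WeierstrassCurve ℚ) [W.IsElliptic] [W.IsGloballyMinimal] (p : ℕ) [Fact p.Prime]

/-- **The remaining input of the X6 sub-locus statements in FRAME FORM (OPEN shape, ∃∧-currency).**
At every erratum-type field `K` for `q` (`X11b.IsErratumField W K q`) with `p` split, every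
parametrisation datum `Dt` at level `N_E` with `p ∤ c`, Heegner datum `H`, embedding `ι`, non-torsion
`K`-rational point `P` read as `heegnerPointComplex Dt H` through `ι`, anticyclotomic `(κ, γ)`, and
for every embedding datum `ι' : ℚ̄_p ≃ ℂ`, infinite place `w₀`, point `P'` read as
`heegnerPointComplex Dt H` through `w₀`, and `e : K → ℚ_p` inducing
`𝔭_{ι'} = X11b.primeOfEmbeddingDatum p ι' w₀.embedding`: THERE IS a frame `(Ω_K ≠ 0, Ω_p ∈ R₀ˣ,
L ∈ R₀⟦T⟧)` with `IsBDPLFunction ι' 𝔭_{ι'} κ γ f_{Dt} Ω_K Ω_p L` [Cas18 Thm. 3.1] ∧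
`L(𝟙) = u·((1 − a_p(E) p⁻¹ + ε_p)·log_{ω_E} P')²`, `u ∈ R₀ˣ`, `ε_p = p⁻¹` if `p ∤ N_E` else `0`
[Cas18 Thm. 3.2, the raw shape of A222] ∧ `Ch_Λ(X_ac^∅(E_K[p^∞]))·R₀⟦T⟧ ⊆ (L)` at `𝔭_{ι'}` FOR THAT
`L` [the shape of CW24 Conj. 5.2 `⊆` / Thm. 5.3, there for CW24's own `L_p^{BDP}`]. The ∃-frame twin
of gen 13's ∀-frame `X6.IMCDivOnErratumData` (which, with `h32`, implies it:
`X6.imcDivFrameOnErratumData_of_thm32_of_imcDiv`); the X6 analogue of multr1-p2's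
`X11b.P2.IMCDivFrameOnTree`. A predicate on `(W, p, q)`; nothing asserted; NEVER a theorem in this
cell; every result using it is CONDITIONAL. Print status: module docstring (first two conjuncts
PUBLISHED at a good `p ≥ 5` for semistable `E` with `ρ̄` irreducible; third conjunct in refereed print
for CW24's normalisation at such a field, modulo the frame concordance — NOT in print).
[cite: Castella2018, Thm. 3.1, display (3.2) and Thm. 3.2 (arXiv:1704.06608 p. 9) (shape only; nothing asserted)]
[cite: CastellaWan2023, Prop. 2.1 (MS p. 6), Conj. 5.2, Thm. 5.3 (MS pp. 23–25) (shape only; nothing asserted)] -/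
def X6.IMCDivFrameOnErratumData [NeZero (W.conductorNorm ℤ)] (q : ℕ) : Prop :=
  ∀ (K : Type) [Field K] [NumberField K]
    (Dt : ModularParametrizationData W (W.conductorNorm ℤ))
    (H : HeegnerDatum (W.conductorNorm ℤ) (NumberField.discr K)) (ι : K →+* ℂ)
    (P : (W.baseChange K).toAffine.Point),
    X11b.IsErratumField W K q → SatisfiesHeegnerHypothesis p K →
    WeierstrassCurve.Affine.Point.map ι.toRatAlgHom P = heegnerPointComplex Dt H →
    ¬ (p : ℤ) ∣ Dt.c → ¬ IsOfFinAddOrder P →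
    ∀ (κ : ZpExtension K p), κ.IsAnticyclotomic →
      ∀ (γ : Field.absoluteGaloisGroup K) [Fact (κ.IsTopGenerator γ)]
        (ι' : PadicAlgCl p ≃+* ℂ) (w₀ : InfinitePlace K) (P' : (W.baseChange K).toAffine.Point),
        WeierstrassCurve.Affine.Point.map w₀.embedding.toRatAlgHom P' = heegnerPointComplex Dt H →
        ∀ (e : K →+* ℚ_[p]),
          (∀ k : 𝓞 K, k ∈ (X11b.primeOfEmbeddingDatum p ι' w₀.embedding).asIdeal ↔
            ‖e (k : K)‖ < 1) →
          ∃ (ΩK : ℂ) (Ωp : (unrIntegers p)ˣ) (L : UnrSeries p), ΩK ≠ 0 ∧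
            IsBDPLFunction ι' (X11b.primeOfEmbeddingDatum p ι' w₀.embedding) κ γ Dt.f ΩK
              ((Ωp : unrIntegers p) : ℂ_[p]) L ∧
            (∃ u : (unrIntegers p)ˣ, L.HasValueAt 0
              (((u : unrIntegers p) : ℂ_[p]) *
                (algebraMap ℚ_[p] ℂ_[p]
                  (((1 : ℚ_[p]) - (W.LFunction p : ℚ_[p]) * (p : ℚ_[p])⁻¹ +
                      (if p ∣ W.conductorNorm ℤ then 0 else (p : ℚ_[p])⁻¹)) *
                    logOmega W p e P')) ^ 2)) ∧
            (XAc.charIdeal (W.baseChange K) p κ (X11b.primeOfEmbeddingDatum p ι' w₀.embedding) ∅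
                γ).map (PowerSeries.map (toUnr p)) ≤ Ideal.span {L}

/-- **The remaining input of lit-glue's classical X6 statement in FRAME FORM (OPEN shape,
∃∧-currency).** At every `K` imaginary quadratic with `d_K < −4`, every `ℓ ∣ N_E` and `p` split,
`L(E^{d_K}, 1) ≠ 0`, every parametrisation datum at level `N_E = N` with `p ∤ c`, Heegner datum,
embedding, non-torsion Heegner point, anticyclotomic `(κ, γ)`, and for every `(ι', w₀, P', e)` as in
`X6.IMCDivFrameOnErratumData`: THERE IS a frame `(Ω_K ≠ 0, Ω_p ∈ R₀ˣ, L)` with `IsBDPLFunction` ∧ the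
value at `𝟙` in A222's raw shape (`ε_p = p⁻¹` if `p ∤ N` else `0`) ∧
`Ch_Λ(X_ac^∅(E_K[p^∞]))·R₀⟦T⟧ ⊆ (L)` FOR THAT `L`. The ∃-frame twin of gen 13's
`X6.IMCDivOnClassicalData`. The third conjunct is NOT in print at a supersingular `p` at an all-split
field (CW24 Thm. 5.3 (ii) fails; CCSS / BSTW are preprints). A predicate on `(W, p)`; nothing
asserted; NEVER a theorem in this cell; every result using it is CONDITIONAL.
[cite: Castella2018, Thm. 3.1, display (3.2) and Thm. 3.2 (arXiv:1704.06608 p. 9) (shape only; nothing asserted)]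
[cite: CastellaWan2023, Conj. 5.2 and Thm. 5.3 (MS p. 23) (shape only; nothing asserted)] -/
def X6.IMCDivFrameOnClassicalData : Prop :=
  ∀ (N : ℕ) [NeZero N] (K : Type) [Field K] [NumberField K]
    (Dt : ModularParametrizationData W N) (H : HeegnerDatum N (NumberField.discr K)) (ι : K →+* ℂ)
    (P : (W.baseChange K).toAffine.Point),
    W.conductorNorm ℤ = N → IsImaginaryQuadratic K → NumberField.discr K < -4 →
    SatisfiesHeegnerHypothesis N K → SatisfiesHeegnerHypothesis p K →
    (W.quadraticTwist (NumberField.discr K : ℚ)).entireLFunction 1 ≠ 0 →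
    WeierstrassCurve.Affine.Point.map ι.toRatAlgHom P = heegnerPointComplex Dt H →
    ¬ (p : ℤ) ∣ Dt.c → ¬ IsOfFinAddOrder P →
    ∀ (κ : ZpExtension K p), κ.IsAnticyclotomic →
      ∀ (γ : Field.absoluteGaloisGroup K) [Fact (κ.IsTopGenerator γ)]
        (ι' : PadicAlgCl p ≃+* ℂ) (w₀ : InfinitePlace K) (P' : (W.baseChange K).toAffine.Point),
        WeierstrassCurve.Affine.Point.map w₀.embedding.toRatAlgHom P' = heegnerPointComplex Dt H →
        ∀ (e : K →+* ℚ_[p]),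
          (∀ k : 𝓞 K, k ∈ (X11b.primeOfEmbeddingDatum p ι' w₀.embedding).asIdeal ↔
            ‖e (k : K)‖ < 1) →
          ∃ (ΩK : ℂ) (Ωp : (unrIntegers p)ˣ) (L : UnrSeries p), ΩK ≠ 0 ∧
            IsBDPLFunction ι' (X11b.primeOfEmbeddingDatum p ι' w₀.embedding) κ γ Dt.f ΩK
              ((Ωp : unrIntegers p) : ℂ_[p]) L ∧
            (∃ u : (unrIntegers p)ˣ, L.HasValueAt 0
              (((u : unrIntegers p) : ℂ_[p]) *
                (algebraMap ℚ_[p] ℂ_[p]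
                  (((1 : ℚ_[p]) - (W.LFunction p : ℚ_[p]) * (p : ℚ_[p])⁻¹ +
                      (if p ∣ N then 0 else (p : ℚ_[p])⁻¹)) *
                    logOmega W p e P')) ^ 2)) ∧
            (XAc.charIdeal (W.baseChange K) p κ (X11b.primeOfEmbeddingDatum p ι' w₀.embedding) ∅
                γ).map (PowerSeries.map (toUnr p)) ≤ Ideal.span {L}

end Shapes

/-! ### §2 The frame form is implied by the gen-13 halves (`h32` + the ∀-frame divisibility) -/

section FromHalves

variable {W : WeierstrassCurve ℚ} [W.IsElliptic] [W.IsGloballyMinimal] {p : ℕ} [Fact p.Prime]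

/-- **Halves ⟹ frame form on erratum-type data**: A222 (`h32`, Cas18 Thms. 3.1–3.2; semistable `E`,
`p ≥ 5`, `ρ̄_{E,p}` irreducible) supplies, at each `(datum, κ, γ, ι', w₀, P', e)`, a frame with the
interpolation property and the value at `𝟙` (`X6.exists_frame_value_of_thm32_erratumField`); the
∀-frame divisibility `X6.IMCDivOnErratumData W p q` supplies the third conjunct AT THAT frame. So the
frame form is not stronger than the gen-13 input granted `h32`. CONDITIONAL on both.
[cite: Castella2018, Thm. 3.1, display (3.2) and Thm. 3.2 (arXiv:1704.06608 p. 9), §5 (p. 12)] -/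
theorem X6.imcDivFrameOnErratumData_of_thm32_of_imcDiv [NeZero (W.conductorNorm ℤ)] {q : ℕ}
    [Fact q.Prime] (h32 : thm32_exists_isBDPLFunction_valueAtOne) (hp5 : 5 ≤ p)
    (hss : Semistable W) (hirr : Irr W p) (hDiv : X6.IMCDivOnErratumData W p q) :
    X6.IMCDivFrameOnErratumData W p q := by
  intro K _ _ Dt H ιK P hKq hHp hP hc hPinf κ hκ γ _ ι' w₀ P' hP' e he
  obtain ⟨ΩK, Ωp, L, hΩ, hL, hval⟩ :=
    X6.exists_frame_value_of_thm32_erratumField h32 ι' Dt H hp5 hss hirr hKq hHp hc w₀ hP' κ hκ γ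
      Fact.out he
  exact ⟨ΩK, Ωp, L, hΩ, hL, hval, hDiv K Dt H ιK P hKq hHp hP hc hPinf κ hκ γ ι' w₀ ΩK Ωp L hL⟩

/-- Class-keyed form of `X6.imcDivFrameOnErratumData_of_thm32_of_imcDiv`: on a class-X6 pair with
`p ≥ 5` (semistable, supersingular hence `ρ̄` irreducible), `h32` + the ∀-frame divisibility ⟹ the
frame form. [cite: Castella2018, Thms. 3.1–3.2 (arXiv:1704.06608 p. 9)] -/
theorem X6.imcDivFrameOnErratumData_of_thm32_of_imcDiv_of_classX6 [NeZero (W.conductorNorm ℤ)]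
    {q : ℕ} [Fact q.Prime] (h32 : thm32_exists_isBDPLFunction_valueAtOne) (hX : ClassX6 W p)
    (hp5 : 5 ≤ p) (hDiv : X6.IMCDivOnErratumData W p q) : X6.IMCDivFrameOnErratumData W p q :=
  X6.imcDivFrameOnErratumData_of_thm32_of_imcDiv h32 hp5 hX.2.1 (ClassX6.irr W p (by omega) hX) hDiv

/-- **Halves ⟹ frame form on classical Heegner data**: A222 (`h32`) at a classical datum
(`X6.exists_frame_value_of_thm32_classical`) + the ∀-frame divisibility `X6.IMCDivOnClassicalData W p`.
CONDITIONAL on both. [cite: Castella2018, Thm. 3.1, display (3.2) and Thm. 3.2 (arXiv:1704.06608 p. 9)]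
[cite: GrossLMS1991, §1 (p. 235)] -/
theorem X6.imcDivFrameOnClassicalData_of_thm32_of_imcDiv
    (h32 : thm32_exists_isBDPLFunction_valueAtOne) (hp5 : 5 ≤ p) (hss : Semistable W)
    (hirr : Irr W p) (hDiv : X6.IMCDivOnClassicalData W p) : X6.IMCDivFrameOnClassicalData W p := by
  intro N _ K _ _ Dt H ιK P hN hK hdisc hHN hHp hLt hP hc hPinf κ hκ γ _ ι' w₀ P' hP' e he
  obtain ⟨ΩK, Ωp, L, hΩ, hL, hval⟩ :=
    X6.exists_frame_value_of_thm32_classical h32 ι' Dt H hN hp5 hss hirr hK hHN hHp hc w₀ hP' κ hκ γ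
      Fact.out he
  exact ⟨ΩK, Ωp, L, hΩ, hL, hval,
    hDiv N K Dt H ιK P hN hK hdisc hHN hHp hLt hP hc hPinf κ hκ γ ι' w₀ ΩK Ωp L hL⟩

/-- Class-keyed form of `X6.imcDivFrameOnClassicalData_of_thm32_of_imcDiv`.
[cite: Castella2018, Thms. 3.1–3.2 (arXiv:1704.06608 p. 9)] -/
theorem X6.imcDivFrameOnClassicalData_of_thm32_of_imcDiv_of_classX6
    (h32 : thm32_exists_isBDPLFunction_valueAtOne) (hX : ClassX6 W p) (hp5 : 5 ≤ p)
    (hDiv : X6.IMCDivOnClassicalData W p) : X6.IMCDivFrameOnClassicalData W p :=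
  X6.imcDivFrameOnClassicalData_of_thm32_of_imcDiv h32 hp5 hX.2.1 (ClassX6.irr W p (by omega) hX)
    hDiv

end FromHalves

end Supersingular

end Summit.BirchSwinnertonDyer.Rank1Residual

end
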